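import Summits.NavierStokesRegularity.NavierStokesRegularity.Theses.SymmetryModuliCount
import Literature.Analysis.FluidPDE.KNSSRemark61

/-!
# Crux `SymmetricLiouville` (stmt-NavierStokesRegularity-4053), negative side: finer cuts of the Type-I and gauge hypotheses

Negative-side (cdisprove, D-0016) support lemmas extracted from
`Cruxes/SymmetricLiouville/Disproof.lean` v5 of route `SymmetryModuliCount`. The crux says: a smooth,
divergence-free, KNSS-mild ancient field on `(−∞,0) × ℝ³` with Type-I time decay
`‖u(t,x)‖ ≤ C/√(−t)` which is annihilated by the generator of a nonzero `ξ ∈ sim(3)` vanishes.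
Two mutants isolate WHICH part of the Type-I hypothesis and of the gauge hypothesis a proof must use:

* `symmetricLiouville_false_typeI_near_zero_bounded_past` — Type-I assumed only on the final window
  `(−1, 0)` plus BOUNDEDNESS of the whole past (everything else as in the crux): FALSE, witnessed by the
  constant field `e_z` (constants are in the gauge class: `e^{σΔ}c = c`, `∫K(σ,x−y)[c,c]dy = 0` by
  oddness of the Koch–Tataru kernel). So the DECAY `‖u(t)‖_∞ → 0` as `t → −∞` is what is used.
* `symmetricLiouville_false_mild_on_window` — the KNSS/Oseen integral equation assumed only between
  times of a final window `(−T, 0)`, with smoothness, divergence, Type-I decay (on ALL `t < 0`) and the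
  symmetry as in the crux: FALSE for every `T > 0`, witnessed by the faded constant `φ_T(t) e_z`
  (`φ_T = smoothTransition(t/T + 2)`: `1` on `[−T,0)`, `0` for `t ≤ −2T`), Type-I with `C = √(2T)`.
  So the gauge condition must reach back to `t = −∞`.

No route statement is changed (`--supports`).
-/

noncomputable section

namespace Summit.NavierStokesRegularity.NavierStokesRegularity.Theorems.SymmetricLiouville.Negative

open Literature.Analysis.FluidPDE MeasureTheory Set Function
open scoped RealInnerProductSpace

/-! ## A unit vector and the constant field -/

/-- The unit vector `e_z` (Lean coordinate `2`). -/
def ez : EuclideanSpace ℝ (Fin 3) := EuclideanSpace.single 2 1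

/-- `‖e_z‖ = 1`. -/
theorem norm_ez : ‖ez‖ = 1 := by
  simp [ez]

/-- `e_z ≠ 0`. -/
theorem ez_ne_zero : ez ≠ 0 := by
  intro h
  have := norm_ez
  rw [h, norm_zero] at this
  exact zero_ne_one this

/-- `ξ = (e_z, 0, 0) ≠ 0`. -/
theorem xi_ez_ne_zero :
    ¬ (ez = 0 ∧ (0 : ℝ) = 0 ∧ (0 : EuclideanSpace ℝ (Fin 3) →L[ℝ] EuclideanSpace ℝ (Fin 3)) = 0) :=
  fun h => ez_ne_zero h.1

/-- A spatially constant field is divergence free. -/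
theorem isDivFree_fun_const (c : EuclideanSpace ℝ (Fin 3)) :
    VectorCalculus.IsDivFree (fun _ : EuclideanSpace ℝ (Fin 3) => c) := by
  intro x
  simp [VectorCalculus.divergence]

/-- A spatially constant field `b(t)` is translation invariant: the symmetry clause of the crux holds
for `ξ = (a, 0, 0)`. -/
theorem translation_symm_of_spatially_const (b : ℝ → EuclideanSpace ℝ (Fin 3))
    (a : EuclideanSpace ℝ (Fin 3)) (t : ℝ) (x : EuclideanSpace ℝ (Fin 3)) :
    fderiv ℝ ((fun t _ => b t) t) x (a + (0 : ℝ) • x + (0 : EuclideanSpace ℝ (Fin 3) →L[ℝ]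
      EuclideanSpace ℝ (Fin 3)) x) + (0 : ℝ) • (fun t _ => b t) t x +
      (2 * (0 : ℝ) * t) • timeDeriv (fun t (_ : EuclideanSpace ℝ (Fin 3)) => b t) t x -
      (0 : EuclideanSpace ℝ (Fin 3) →L[ℝ] EuclideanSpace ℝ (Fin 3)) ((fun t _ => b t) t x) = 0 := by
  simp

/-- **Constants are KNSS-mild**: the Oseen integral equation between `s < t` for the constant field
`c` (`e^{σΔ}c = c`, `∫ K(σ, x − y)[c, c] dy = 0`; KNSS 2009 Rem. 6.1). -/
theorem const_mild (c : EuclideanSpace ℝ (Fin 3)) {s t : ℝ} (hst : s < t) (x : EuclideanSpace ℝ (Fin 3)) :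
    c = heatFlow (fun _ : EuclideanSpace ℝ (Fin 3) => c) (t - s) x -
      ∫ τ in Set.Ioo s t, ∫ y, oseenKernel (t - τ) (x - y) c c := by
  have hσ : 0 < t - s := sub_pos.2 hst
  rw [heatFlow_of_pos _ hσ, Literature.Analysis.UnboundedOperators.heatExtension_const c hσ x]
  simp [integral_oseenKernel_sub_left_eq_zero]

/-! ## Type-I near `t = 0` plus a bounded past does not suffice -/

/-- The crux with Type-I decay assumed only on the final window `(−1, 0)` and mere BOUNDEDNESS on
the whole past (all other clauses verbatim). -/
def SymmetricLiouvilleTypeINearZeroBoundedPast : Prop :=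
  ∀ (C : ℝ) (u : ℝ → EuclideanSpace ℝ (Fin 3) → EuclideanSpace ℝ (Fin 3)),
    ContDiffOn ℝ (⊤ : ℕ∞) (Function.uncurry u) (Set.Iio 0 ×ˢ Set.univ) →
    (∀ t < 0, VectorCalculus.IsDivFree (u t)) →
    (∀ s t : ℝ, s < t → t < 0 → ∀ x, u t x = heatFlow (u s) (t - s) x -
        ∫ τ in Set.Ioo s t, ∫ y, oseenKernel (t - τ) (x - y) (u τ y) (u τ y)) →
    (∀ t ∈ Set.Ioo (-1 : ℝ) 0, ∀ x, ‖u t x‖ ≤ C / Real.sqrt (-t)) → (∀ t < 0, ∀ x, ‖u t x‖ ≤ C) →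
    ∀ (a : EuclideanSpace ℝ (Fin 3)) (σ : ℝ) (A : EuclideanSpace ℝ (Fin 3) →L[ℝ] EuclideanSpace ℝ (Fin 3)),
      (∀ x, ⟪A x, x⟫ = 0) → ¬ (a = 0 ∧ σ = 0 ∧ A = 0) →
      (∀ t < 0, ∀ x, fderiv ℝ (u t) x (a + σ • x + A x) + σ • u t x +
        (2 * σ * t) • timeDeriv u t x - A (u t x) = 0) →
      ∀ t < 0, ∀ x, u t x = 0

/-- **The decay at `t = −∞` is load-bearing**: Type-I on the final window plus boundedness of the
whole past does not suffice — the constant field `e_z` satisfies all of it (`1 ≤ 1/√(−t)` on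
`(−1,0)`), is in the gauge class and translation invariant, yet nonzero. A proof of the crux must use
`‖u(t)‖_∞ → 0` as `t → −∞`. -/
theorem symmetricLiouville_false_typeI_near_zero_bounded_past :
    ¬ SymmetricLiouvilleTypeINearZeroBoundedPast := by
  intro h
  have key := h 1 (fun _ _ => ez) contDiffOn_const (fun _ _ => isDivFree_fun_const ez)
    (fun s t hst _ x => const_mild ez hst x) ?_ (fun t _ x => by simp [norm_ez]) ez 0 0
    (fun x => by simp) xi_ez_ne_zero (fun t _ x => translation_symm_of_spatially_const (fun _ => ez) ez t x)
    (-1) (by norm_num) 0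
  · exact ez_ne_zero key
  · rintro t ⟨ht1, ht2⟩ x
    have hs : 0 < Real.sqrt (-t) := Real.sqrt_pos.2 (by linarith)
    have hs1 : Real.sqrt (-t) ≤ 1 := by
      rw [Real.sqrt_le_left zero_le_one]
      linarith
    rw [le_div_iff₀ hs, norm_ez]
    calc (1 : ℝ) * Real.sqrt (-t) ≤ 1 * 1 := by gcongr
      _ = 1 := one_mul _

/-! ## The gauge condition must reach back to `t = −∞` -/

/-- A smooth fade: `φ_T(t) = smoothTransition (t/T + 2)`. -/
def fade (T : ℝ) (t : ℝ) : ℝ := Real.smoothTransition (t / T + 2)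

/-- `φ_T = 1` on `[−T, ∞)`. -/
theorem fade_eq_one {T t : ℝ} (hT : 0 < T) (ht : -T ≤ t) : fade T t = 1 := by
  unfold fade
  apply Real.smoothTransition.one_of_one_le
  have : -1 ≤ t / T := by rw [le_div_iff₀ hT]; linarith
  linarith

/-- `φ_T = 0` on `(−∞, −2T]`. -/
theorem fade_eq_zero {T t : ℝ} (hT : 0 < T) (ht : t ≤ -(2 * T)) : fade T t = 0 := by
  unfold fade
  apply Real.smoothTransition.zero_of_nonpos
  have : t / T ≤ -2 := by rw [div_le_iff₀ hT]; linarith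
  linarith

/-- `0 ≤ φ_T ≤ 1`. -/
theorem fade_mem_Icc (T t : ℝ) : fade T t ∈ Set.Icc (0 : ℝ) 1 :=
  ⟨Real.smoothTransition.nonneg _, Real.smoothTransition.le_one _⟩

/-- The **faded constant** `u(t, x) = φ_T(t) • e_z`. -/
def fadedConst (T : ℝ) : ℝ → EuclideanSpace ℝ (Fin 3) → EuclideanSpace ℝ (Fin 3) := fun t _ => fade T t • ez

/-- The faded constant is jointly smooth. -/
theorem fadedConst_contDiff (T : ℝ) : ContDiff ℝ (⊤ : ℕ∞) (Function.uncurry (fadedConst T)) := by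
  have h : ContDiff ℝ (⊤ : ℕ∞) (fun p : ℝ × EuclideanSpace ℝ (Fin 3) => fade T p.1) :=
    Real.smoothTransition.contDiff.comp ((contDiff_fst.div_const T).add contDiff_const)
  exact h.smul contDiff_const

/-- The crux with the KNSS/Oseen integral equation assumed only between times of the final window
`(−T, 0)` (smoothness, divergence, Type-I decay and the symmetry for all `t < 0`, verbatim). -/
def SymmetricLiouvilleMildOnWindow (T : ℝ) : Prop :=
  ∀ (C : ℝ) (u : ℝ → EuclideanSpace ℝ (Fin 3) → EuclideanSpace ℝ (Fin 3)),
    ContDiffOn ℝ (⊤ : ℕ∞) (Function.uncurry u) (Set.Iio 0 ×ˢ Set.univ) →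
    (∀ t < 0, VectorCalculus.IsDivFree (u t)) →
    (∀ s t : ℝ, -T < s → s < t → t < 0 → ∀ x, u t x = heatFlow (u s) (t - s) x -
        ∫ τ in Set.Ioo s t, ∫ y, oseenKernel (t - τ) (x - y) (u τ y) (u τ y)) →
    HasTypeITimeDecay C u →
    ∀ (a : EuclideanSpace ℝ (Fin 3)) (σ : ℝ) (A : EuclideanSpace ℝ (Fin 3) →L[ℝ] EuclideanSpace ℝ (Fin 3)),
      (∀ x, ⟪A x, x⟫ = 0) → ¬ (a = 0 ∧ σ = 0 ∧ A = 0) →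
      (∀ t < 0, ∀ x, fderiv ℝ (u t) x (a + σ • x + A x) + σ • u t x +
        (2 * σ * t) • timeDeriv u t x - A (u t x) = 0) →
      ∀ t < 0, ∀ x, u t x = 0

/-- **The gauge must reach `t = −∞`**: with the Oseen equation only on a final window `(−T, 0)` the
crux is FALSE for every `T > 0` — the faded constant `φ_T(t) e_z` is smooth, divergence free, Type-I
on ALL of `t < 0` with `C = √(2T)` (it vanishes for `t ≤ −2T`, and `√(−t) ≤ √(2T)` after),
translation invariant, satisfies the Oseen equation between any two times of the window (where it is
the constant `e_z`), yet `u(−T/2) = e_z ≠ 0`. (It is not in `𝒜_C`: between `s < −2T` and `t > −T`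
the equation fails.) -/
theorem symmetricLiouville_false_mild_on_window {T : ℝ} (hT : 0 < T) :
    ¬ SymmetricLiouvilleMildOnWindow T := by
  intro h
  have hval : ∀ t, -T ≤ t → ∀ x : EuclideanSpace ℝ (Fin 3), fadedConst T t x = ez := fun t ht x => by
    simp [fadedConst, fade_eq_one hT ht]
  have key := h (Real.sqrt (2 * T)) (fadedConst T) (fadedConst_contDiff T).contDiffOn
    (fun t _ => isDivFree_fun_const _) ?_ ?_ ez 0 0 (fun x => by simp) xi_ez_ne_zero
    (fun t _ x => translation_symm_of_spatially_const (fun t => fade T t • ez) ez t x)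
    (-T / 2) (by linarith) 0
  · rw [hval (-T / 2) (by linarith)] at key
    exact ez_ne_zero key
  · -- the Oseen equation on the window, where the field is the constant `e_z`
    intro s t hs hst _ x
    have hus : fadedConst T s = fun _ : EuclideanSpace ℝ (Fin 3) => ez := funext (hval s hs.le)
    rw [hval t (by linarith) x, hus]
    have hD : ∫ τ in Set.Ioo s t, ∫ y, oseenKernel (t - τ) (x - y) (fadedConst T τ y)
        (fadedConst T τ y) = ∫ τ in Set.Ioo s t, ∫ y, oseenKernel (t - τ) (x - y) ez ez := by
      refine setIntegral_congr_fun measurableSet_Ioo fun τ hτ => ?_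
      have hτ' : -T ≤ τ := by linarith [hτ.1]
      simp only [hval τ hτ']
    rw [hD]
    exact const_mild ez hst x
  · -- Type-I on all of `t < 0` with `C = √(2T)`
    intro t ht x
    have hst : 0 < Real.sqrt (-t) := Real.sqrt_pos.2 (by linarith)
    rcases le_or_gt t (-(2 * T)) with h2 | h2
    · have : fadedConst T t x = 0 := by simp [fadedConst, fade_eq_zero hT h2]
      rw [this, norm_zero]
      positivity
    · have hle : Real.sqrt (-t) ≤ Real.sqrt (2 * T) := Real.sqrt_le_sqrt (by linarith)
      rw [le_div_iff₀ hst]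
      have hn : ‖fadedConst T t x‖ ≤ 1 := by
        simp only [fadedConst, norm_smul, norm_ez, mul_one, Real.norm_eq_abs,
          abs_of_nonneg (fade_mem_Icc T t).1]
        exact (fade_mem_Icc T t).2
      calc ‖fadedConst T t x‖ * Real.sqrt (-t) ≤ 1 * Real.sqrt (2 * T) := by gcongr
        _ = Real.sqrt (2 * T) := one_mul _

end Summit.NavierStokesRegularity.NavierStokesRegularity.Theorems.SymmetricLiouville.Negative

end
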